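import Mathlib
import HarnessLib
import Summits.HubbardSuperconductivity.HubbardSuperconductivity.Theorems.KLProgrammeKLRegimeEnginePairTransferStep7AnalyticResolvedConvK
import Summits.HubbardSuperconductivity.HubbardSuperconductivity.Theorems.KLProgrammeKLRegimeEnginePairTransferMemberPHTailPhGain

/-!
# Route `KLProgramme` — ENGINE child gen 8 (stmt-HubbardSuperconductivity-20437 `KLRegimeEngineV17F2`), skeleton v2 class #5 rev 3:
# the (R200) acceptance-test producer AT THE ENGINE'S TWO-SHELL PACKAGE, (X).3 CONJUNCT FORM — `exists_isTransferPkg7_of_analytic_resolved_conv_klTS`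
# (cell gate-hubbard-kl, seat hubbard-kl-k3c1-p1 g15; row 68 of CLASS5-RESOLVED-STEP.md / KLTC-INDEX v12; candidate order «68» = «54b-RESOLVED» typed and kit-free)

`∃ e, IsTransferPkg7 e ∧ PairTransferStep7 P R Q₀ G Gth e.1 e.2` — the second conjunct of rev-14 `stub_engine_exports` — from row 67′ `pairTransferStep7_of_analytic_resolved_convK`
(…Step7AnalyticResolvedConvK, p643692) with its thresholds kit DISCHARGED at the engine's two-shell package (`twoShellFrameAreaAt_klTS`, `klTS_nonneg`, k3c2-p2 g15):
* `U ≤ klTSU R` — granted by SHRINKING the transfer package's own `U`-threshold to `u′ Q cc = min (u Q cc) (klTSU R)` (still positive: `klTSU_pos`), every hypothesis of the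
  producer being antitone in the threshold;
* `π/(4β) ≤ Λₙ₊₁` (every `n ≤ n_β`: `pi_div_four_mul_le_klScale_of_le_nScales_succ`), `G·(2π/L) ≤ Λₙ₊₁` (every `n`: `≤ π/(4β)` from `8Gβ ≤ L`), `2Λₙ + G·(2π/L) ≤ klE0`
  (`1 ≤ n`: k3c2-p2 g18 `tail_regime_readings`) — from the ONE lattice-size row `8·(4 + (8/3)·Gfr₁·U²)·β ≤ L` («hGL», asked in the loop's context; the thresholds' owner
  closes it from `klEngL₄ ≤ L` once `Gfr₁·U²` is capped in the regime).
What stays hypothesis: row 67′'s BASE / STEP / EXPORT bundles verbatim (kernel sups and differences [class #1], the ≥2-cross and `(x,y)`-difference masses [k3c2-p2],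
localisation rows [(c) closer], (F)(i), the WINDOW DATA of the relative-weight profile [«(ᾱ)-WINDOW», p1], the ONE budget row per scale), `hGL`, the cap `r ≤ klCTcap7`,
`0 < u`.  Composition only; nothing asserts (X).3, (c), K3 or superconductivity.  0 kit · 0 lit.
-/

noncomputable section

namespace Summit.HubbardSuperconductivity.HubbardSuperconductivity.Theorems.KLRegimeSplit

set_option linter.dupNamespace false -- summit = problem name (single-conjunct summit), D-0017

open Finset Matrix Set Literature.MathematicalPhysics.QuantumLattice Literature.Probability.LatticeModels GrassmannAlgebra
open Literature.MathematicalPhysics.QuantumLattice.FermiRG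
open Summit.HubbardSuperconductivity.HubbardSuperconductivity.Theorems.KLProgrammeCooperResummation
open Summit.HubbardSuperconductivity.HubbardSuperconductivity.Theorems.KLProgrammeLegKernels
open Summit.HubbardSuperconductivity.HubbardSuperconductivity.Theorems.TwoPointAssembly
open Summit.HubbardSuperconductivity.HubbardSuperconductivity.Theorems.DispersionFlow
open Summit.HubbardSuperconductivity.HubbardSuperconductivity.Theorems.KLRegimeWick
open Summit.HubbardSuperconductivity.HubbardSuperconductivity.Theorems.EngineV8

section Producer

set_option maxHeartbeats 3200000 in -- long binder lists + the analytic bundle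
/-- **`exists_isTransferPkg7_of_analytic_resolved_conv_klTS`** — the rev-14 (X).3 conjunct from row 67′'s bundles at the engine's two-shell package `(klTS, klTSU)`,
the kit discharged to the lattice-size row `8Gβ ≤ L` (module docstring). -/
theorem exists_isTransferPkg7_of_analytic_resolved_conv_klTS {P : SplitConsts} {R : RenConsts} {Q₀ : EngConsts} {G Gth : GeoConsts} {r θ : ℝ} {u : EngConsts → ℝ → ℝ}
    (mA : ℝ → ℝ) (hR : R.WF2) (hCF : 0 ≤ Gth.CF) (hKl : 0 ≤ P.Klam) (hr : 0 ≤ r) (hrc : r ≤ klCTcap7) (hu : ∀ Q cc, 0 < u Q cc)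
    (hθ0 : 0 ≤ θ) (hθ : θ ≤ 1 / 5)
    (h0 : ∀ (U μ β : ℝ), μ ∈ klWindowC → FrameOK R U (nScales β) μ 0)
    (hmA : ∀ (Q : EngConsts) (cc U : ℝ), 0 < U → U ≤ u Q cc → 0 ≤ mA U ∧ mA U * ((2 : ℝ) ^ 10 * 15367) ≤ 1 / 3)
    -- the ONE lattice-size row the two-shell convolution needs («hGL», in the loop's context)
    (hGL : ∀ cc : ℝ, 0 < cc → cc ≤ klEngC₃6 P R → ∀ U : ℝ, 0 < U → U ≤ klEngU₀10 P R cc → ∀ β : ℝ, klBetaMin ≤ β → β ≤ Real.exp (cc / U ^ 2) →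
      ∀ L : ℕ, klEngL₄ P R β U ≤ L → 8 * (4 + 8 / 3 * R.Gfr 1 * U ^ 2) * β ≤ L)
    (hbase : G.WF → ∀ Q : EngConsts, Q₀.IsRaiseOf Q →
      ∀ cc : ℝ, 0 < cc → cc ≤ klEngC₃6 P R →
        ∀ μ ∈ klWindowC, ∀ U : ℝ, 0 < U → U ≤ klEngU₀10 P R cc → U ≤ u Q cc →
          ∀ β : ℝ, klBetaMin ≤ β → β ≤ Real.exp (cc / U ^ 2) →
            ∀ (L M : ℕ) [NeZero L] [NeZero M], klEngL₄ P R β U ≤ L → klEngM₃ β U L ≤ M →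
              0 ≤ nScales β + 1 → IsKLRegime U cc (-((0 : ℕ) : ℤ)) →
                HistP klPredsV17F2 L M G P Q R β U μ 0 0 →
                  FrameOK R U (nScales β) μ (klFlowFrameU L M β U μ 0) →
                    (∀ j ≤ 0, LevelsUExportMixedAt L M (klCU2 P R Q₀) P β U μ j) →
      ∀ j j' : ℕ, 0 ≤ j' → j' ≤ j → j ≤ nScales β + 1 → ∀ Qm : TorusSite 2 L, IsPairClassAt L Qm 0 →
      -- BASE CLOSED at scale 0 (k3c1-p1 g14 rows 52/52b `klmg_memberAmplitude_sub_le_sq` / `klmf_baseData_of_scaleZero`; regime rows from the thresholds): the two a priori rows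
      -- [class #1] and ONE scalar inequality of the depth `j′` (`klTransferC R` = k3c2-p1 g5's closed scale-0 transfer constant)
      (∀ x y, ‖klMemberArrayF L M β U μ 0 (softSymbolCompl L M β μ (klFlowFrameU L M β U μ 0) 0 j) Qm x y‖ ≤ mA U) ∧
        (∀ x y, ‖klMemberArrayF L M β U μ 0 (softSymbolCompl L M β μ (klFlowFrameU L M β U μ 0) 0 j') Qm x y‖ ≤ mA U) ∧
        4 / 6047 * klIdxMass 0 j' * (klTransferC R * U ^ 2) + 4 * (mA U * mA U) * klIdxMass 0 j' ≤ θ * (r * ((P.Klam * U) ^ 2 * klIdxMass 0 j')))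
    (hsucc : G.WF → ∀ Q : EngConsts, Q₀.IsRaiseOf Q →
      ∀ cc : ℝ, 0 < cc → cc ≤ klEngC₃6 P R →
        ∀ μ ∈ klWindowC, ∀ U : ℝ, 0 < U → U ≤ klEngU₀10 P R cc → U ≤ u Q cc →
          ∀ β : ℝ, klBetaMin ≤ β → β ≤ Real.exp (cc / U ^ 2) →
            ∀ (L M : ℕ) [NeZero L] [NeZero M], klEngL₄ P R β U ≤ L → klEngM₃ β U L ≤ M →
              ∀ n : ℕ, n + 1 ≤ nScales β + 1 → IsKLRegime U cc (-((n + 1 : ℕ) : ℤ)) →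
                HistP klPredsV17F2 L M G P Q R β U μ 0 (n + 1) →
                  FrameOK R U (nScales β) μ (klFlowFrameU L M β U μ (n + 1)) →
                    (∀ j ≤ n + 1, LevelsUExportMixedAt L M (klCU2 P R Q₀) P β U μ j) →
      (∀ Λ ∈ Icc (klScale klE0 (n + 1)) (klScale klE0 n), hubbardEffPartitionFnCT L M β U μ 0 (klFlowFrameU L M β U μ (n + 1)) Λ ≠ 0) ∧
      ∀ (A A' : ℕ → TorusSite 2 L → ℝ → Matrix (TorusSite 2 L) (TorusSite 2 L) ℂ) (b b' : ℕ → TorusSite 2 L → ℝ → TorusSite 2 L → ℂ)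
        (a : ℕ → ℕ → TorusSite 2 L → ℝ → TorusSite 2 L → ℂ) (ρ : ℕ → TorusSite 2 L → TorusSite 2 L → ℝ)
        (V : ℕ → ℝ → (Fin 4 → HubbardFieldIdx L M) → ℂ) (V6 : ℕ → ℝ → (Fin 6 → HubbardFieldIdx L M) → ℂ) (Sg : ℕ → ℝ → FreqMomentum L M → Fin 2 → ℂ) (Hd : ℕ → ℝ → (Fin 4 → HubbardFieldIdx L M) → ℂ) (Φ : ℕ → ℝ → FreqMomentum L M → ℝ) (Wd : ℝ →
                FreqMomentum L M → ℝ) (Br : ℕ → TorusSite 2 L → ℝ → TorusSite 2 L × MatsubaraIdx M → ℂ),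
        (A = fun j Qm t => Matrix.of fun k k' : TorusSite 2 L => if k ∈ klBall L μ 0 ∧ k' ∈ klBall L μ 0 then
      vertexFn L M β (gaussConv ℂ
        (softCovOf L M β μ (klFlowFrameU L M β U μ (n + 1)) (softSymbolCompl L M β μ (klFlowFrameU L M β U μ (n + 1)) (n + 1) j) + hubbardCovAboveCT L M β μ 0 (klFlowFrameU L M β U μ (n + 1)) (klScale klE0 (n + 1)) -
          hubbardCovAboveCT L M β μ 0 (klFlowFrameU L M β U μ (n + 1)) (klScale klE0 n + t * (klScale klE0 (n + 1) - klScale klE0 n)))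
        (hubbardEffectiveActionCT L M β U μ 0 (klFlowFrameU L M β U μ (n + 1)) (klScale klE0 n + t * (klScale klE0 (n + 1) - klScale klE0 n)))) 4
        ![(((omega0 M, k'), 0), 0), ((((omega0 M).rev, Qm - k'), 1), 0), ((((omega0 M).rev, Qm - k), 1), 1), (((omega0 M, k), 0), 1)]
      else 0) →
        (A' = fun j Qm t => Matrix.of fun k k' : TorusSite 2 L => if k ∈ klBall L μ 0 ∧ k' ∈ klBall L μ 0 then
      (klScale klE0 (n + 1) - klScale klE0 n) • -((2 : ℂ)⁻¹ * vertexFn L M β (gaussConv ℂ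
        (softCovOf L M β μ (klFlowFrameU L M β U μ (n + 1)) (softSymbolCompl L M β μ (klFlowFrameU L M β U μ (n + 1)) (n + 1) j) + hubbardCovAboveCT L M β μ 0 (klFlowFrameU L M β U μ (n + 1)) (klScale klE0 (n + 1)) -
          hubbardCovAboveCT L M β μ 0 (klFlowFrameU L M β U μ (n + 1)) (klScale klE0 n + t * (klScale klE0 (n + 1) - klScale klE0 n)))
        (grassmannDerivPairing ℂ
          (Matrix.of fun X Y : HubbardFieldIdx L M => deriv (fun Λ'' : ℝ => hubbardCovAboveCT L M β μ 0 (klFlowFrameU L M β U μ (n + 1)) Λ'' X Y)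
            (klScale klE0 n + t * (klScale klE0 (n + 1) - klScale klE0 n)))
          (hubbardEffectiveActionCT L M β U μ 0 (klFlowFrameU L M β U μ (n + 1)) (klScale klE0 n + t * (klScale klE0 (n + 1) - klScale klE0 n)))
          (hubbardEffectiveActionCT L M β U μ 0 (klFlowFrameU L M β U μ (n + 1)) (klScale klE0 n + t * (klScale klE0 (n + 1) - klScale klE0 n))))) 4
        ![(((omega0 M, k'), 0), 0), ((((omega0 M).rev, Qm - k'), 1), 0), ((((omega0 M).rev, Qm - k), 1), 1), (((omega0 M, k), 0), 1)])
      else 0) →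
        (b = fun j Qm t p => -((klBubbleMass L M β μ (klFlowFrameU L M β U μ (n + 1))
        (fun k => (softSymbolCompl L M β μ (klFlowFrameU L M β U μ (n + 1)) (n + 1) j) k + (hubbardCutoffWeightCT L M β μ (klFlowFrameU L M β U μ (n + 1)) (klScale klE0 (n + 1)) k -
          hubbardCutoffWeightCT L M β μ (klFlowFrameU L M β U μ (n + 1)) (klScale klE0 n + t * (klScale klE0 (n + 1) - klScale klE0 n)) k))
        (fun k => (softSymbolCompl L M β μ (klFlowFrameU L M β U μ (n + 1)) (n + 1) j) k + (hubbardCutoffWeightCT L M β μ (klFlowFrameU L M β U μ (n + 1)) (klScale klE0 (n + 1)) k -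
          hubbardCutoffWeightCT L M β μ (klFlowFrameU L M β U μ (n + 1)) (klScale klE0 n + t * (klScale klE0 (n + 1) - klScale klE0 n)) k)) Qm p : ℝ) : ℂ)) →
        (b' = fun j Qm t p => (((klScale klE0 (n + 1) - klScale klE0 n) *
        (klBubbleMass L M β μ (klFlowFrameU L M β U μ (n + 1))
            (fun k => deriv (fun Λ' => hubbardCutoffWeightCT L M β μ (klFlowFrameU L M β U μ (n + 1)) Λ' k) (klScale klE0 n + t * (klScale klE0 (n + 1) - klScale klE0 n)))
            (fun k => (softSymbolCompl L M β μ (klFlowFrameU L M β U μ (n + 1)) (n + 1) j) k + (hubbardCutoffWeightCT L M β μ (klFlowFrameU L M β U μ (n + 1)) (klScale klE0 (n + 1)) k -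
          hubbardCutoffWeightCT L M β μ (klFlowFrameU L M β U μ (n + 1)) (klScale klE0 n + t * (klScale klE0 (n + 1) - klScale klE0 n)) k)) Qm p +
          klBubbleMass L M β μ (klFlowFrameU L M β U μ (n + 1))
            (fun k => (softSymbolCompl L M β μ (klFlowFrameU L M β U μ (n + 1)) (n + 1) j) k + (hubbardCutoffWeightCT L M β μ (klFlowFrameU L M β U μ (n + 1)) (klScale klE0 (n + 1)) k -
          hubbardCutoffWeightCT L M β μ (klFlowFrameU L M β U μ (n + 1)) (klScale klE0 n + t * (klScale klE0 (n + 1) - klScale klE0 n)) k))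
            (fun k => deriv (fun Λ' => hubbardCutoffWeightCT L M β μ (klFlowFrameU L M β U μ (n + 1)) Λ' k) (klScale klE0 n + t * (klScale klE0 (n + 1) - klScale klE0 n)))
            Qm p) : ℝ) : ℂ)) →
        (a = fun j j' Qm t p => (b j Qm t p - b j' Qm t p) +
      (-(((klTransferWeight L M β μ (klFlowFrameU L M β U μ (n + 1)) (n + 1) (softSymbolCompl L M β μ (klFlowFrameU L M β U μ (n + 1)) (n + 1) j) Qm p -
          klTransferWeight L M β μ (klFlowFrameU L M β U μ (n + 1)) (n + 1) (softSymbolCompl L M β μ (klFlowFrameU L M β U μ (n + 1)) (n + 1) j') Qm p : ℝ)) : ℂ) -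
        (b j Qm 1 p - b j' Qm 1 p))) →
        (ρ = fun j Qm c => klRungProfile L M β μ (klFlowFrameU L M β U μ (n + 1)) n (softSymbolCompl L M β μ (klFlowFrameU L M β U μ (n + 1)) (n + 1) j) Qm c) →
        (V = fun j t X => vertexFn L M β (gaussConv ℂ (softCovOf L M β μ (klFlowFrameU L M β U μ (n + 1)) (softSymbolCompl L M β μ (klFlowFrameU L M β U μ (n + 1)) (n + 1) j) + hubbardCovAboveCT L M β μ 0 (klFlowFrameU L M β U μ (n + 1)) (klScale
                klE0 (n + 1)) - hubbardCovAboveCT L M β μ 0 (klFlowFrameU L M β U μ (n + 1)) (klScale klE0 n + t * (klScale klE0 (n + 1) - klScale klE0 n))) (hubbardEffectiveActionCT L M β U μ 0 (klFlowFrameU L M β U μ (n + 1)) (klScale klE0 n + t *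
                (klScale klE0 (n + 1) - klScale klE0 n)))) 4 X) →
        (V6 = fun j t X => vertexFn L M β (gaussConv ℂ (softCovOf L M β μ (klFlowFrameU L M β U μ (n + 1)) (softSymbolCompl L M β μ (klFlowFrameU L M β U μ (n + 1)) (n + 1) j) + hubbardCovAboveCT L M β μ 0 (klFlowFrameU L M β U μ (n + 1)) (klScale
                klE0 (n + 1)) - hubbardCovAboveCT L M β μ 0 (klFlowFrameU L M β U μ (n + 1)) (klScale klE0 n + t * (klScale klE0 (n + 1) - klScale klE0 n))) (hubbardEffectiveActionCT L M β U μ 0 (klFlowFrameU L M β U μ (n + 1)) (klScale klE0 n + t *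
                (klScale klE0 (n + 1) - klScale klE0 n)))) 6 X) →
        (Sg = fun j t p σ => selfEnergy L M β (gaussConv ℂ (softCovOf L M β μ (klFlowFrameU L M β U μ (n + 1)) (softSymbolCompl L M β μ (klFlowFrameU L M β U μ (n + 1)) (n + 1) j) + hubbardCovAboveCT L M β μ 0 (klFlowFrameU L M β U μ (n + 1))
                (klScale klE0 (n + 1)) - hubbardCovAboveCT L M β μ 0 (klFlowFrameU L M β U μ (n + 1)) (klScale klE0 n + t * (klScale klE0 (n + 1) - klScale klE0 n))) (hubbardEffectiveActionCT L M β U μ 0 (klFlowFrameU L M β U μ (n + 1)) (klScale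
                klE0 n + t * (klScale klE0 (n + 1) - klScale klE0 n)))) p σ) →
        (Hd = fun j t X => vertexFn L M β (dblFold ℂ (grassmannLaplacian ℂ (crossCov ℂ (Matrix.of fun X Y : HubbardFieldIdx L M => deriv (fun Λ' : ℝ => hubbardCovAboveCT L M β μ 0 (klFlowFrameU L M β U μ (n + 1)) Λ' X Y) (klScale klE0 n + t *
                (klScale klE0 (n + 1) - klScale klE0 n)))) ((gaussConv ℂ (crossCov ℂ (softCovOf L M β μ (klFlowFrameU L M β U μ (n + 1)) (softSymbolCompl L M β μ (klFlowFrameU L M β U μ (n + 1)) (n + 1) j) + hubbardCovAboveCT L M β μ 0 (klFlowFrameU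
                L M β U μ (n + 1)) (klScale klE0 (n + 1)) - hubbardCovAboveCT L M β μ 0 (klFlowFrameU L M β U μ (n + 1)) (klScale klE0 n + t * (klScale klE0 (n + 1) - klScale klE0 n)))) - grassmannLaplacian ℂ (crossCov ℂ (softCovOf L M β μ
                (klFlowFrameU L M β U μ (n + 1)) (softSymbolCompl L M β μ (klFlowFrameU L M β U μ (n + 1)) (n + 1) j) + hubbardCovAboveCT L M β μ 0 (klFlowFrameU L M β U μ (n + 1)) (klScale klE0 (n + 1)) - hubbardCovAboveCT L M β μ 0 (klFlowFrameU L
                M β U μ (n + 1)) (klScale klE0 n + t * (klScale klE0 (n + 1) - klScale klE0 n))))) (dblCopy ℂ 0 (gaussConv ℂ (softCovOf L M β μ (klFlowFrameU L M β U μ (n + 1)) (softSymbolCompl L M β μ (klFlowFrameU L M β U μ (n + 1)) (n + 1) j) +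
                hubbardCovAboveCT L M β μ 0 (klFlowFrameU L M β U μ (n + 1)) (klScale klE0 (n + 1)) - hubbardCovAboveCT L M β μ 0 (klFlowFrameU L M β U μ (n + 1)) (klScale klE0 n + t * (klScale klE0 (n + 1) - klScale klE0 n)))
                (hubbardEffectiveActionCT L M β U μ 0 (klFlowFrameU L M β U μ (n + 1)) (klScale klE0 n + t * (klScale klE0 (n + 1) - klScale klE0 n)))) * dblCopy ℂ 1 (gaussConv ℂ (softCovOf L M β μ (klFlowFrameU L M β U μ (n + 1)) (softSymbolCompl L
                M β μ (klFlowFrameU L M β U μ (n + 1)) (n + 1) j) + hubbardCovAboveCT L M β μ 0 (klFlowFrameU L M β U μ (n + 1)) (klScale klE0 (n + 1)) - hubbardCovAboveCT L M β μ 0 (klFlowFrameU L M β U μ (n + 1)) (klScale klE0 n + t * (klScale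
                klE0 (n + 1) - klScale klE0 n))) (hubbardEffectiveActionCT L M β U μ 0 (klFlowFrameU L M β U μ (n + 1)) (klScale klE0 n + t * (klScale klE0 (n + 1) - klScale klE0 n)))))))) 4 X) →
        (Φ = fun j t k => (softSymbolCompl L M β μ (klFlowFrameU L M β U μ (n + 1)) (n + 1) j) k + (hubbardCutoffWeightCT L M β μ (klFlowFrameU L M β U μ (n + 1)) (klScale klE0 (n + 1)) k - hubbardCutoffWeightCT L M β μ (klFlowFrameU L M β U μ (n +
                1)) (klScale klE0 n + t * (klScale klE0 (n + 1) - klScale klE0 n)) k)) →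
        (Wd = fun t k => deriv (fun Λ' : ℝ => hubbardCutoffWeightCT L M β μ (klFlowFrameU L M β U μ (n + 1)) Λ' k) (klScale klE0 n + t * (klScale klE0 (n + 1) - klScale klE0 n))) →
        (Br = fun j Qm t z => -(((((β * (L : ℝ) ^ 2 : ℝ) : ℂ)))⁻¹ * propCT L M β μ (klFlowFrameU L M β U μ (n + 1)) (z.2, z.1) * propCT L M β μ (klFlowFrameU L M β U μ (n + 1)) (z.2.rev, Qm - z.1)) *
      ((((klScale klE0 (n + 1) - klScale klE0 n) * (-Wd t (z.2, z.1) * Φ j t (z.2.rev, Qm - z.1) - Φ j t (z.2, z.1) * Wd t (z.2.rev, Qm - z.1))) : ℝ) : ℂ)) →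
      ∀ j j' : ℕ, n + 1 ≤ j' → j' ≤ j → j ≤ nScales β + 1 → ∀ Qm : TorusSite 2 L, IsPairClassAt L Qm (n + 1) →
      ∃ (ηr η₁ η₂ R₀ Ran : TorusSite 2 L → TorusSite 2 L → ℝ) (d α : TorusSite 2 L → ℝ) (M4 M6 M2 η4 η6 η2 η₀ Aw Z : ℝ) (Ish : ℕ)
        (RH₁ RH₂ Rhd W6₁ Wd₂ Wx₂ W6₂ WD₁ WD₂ WD₃ RL₁ RL₂ Rl₁ Rl₂ : TorusSite 2 L → TorusSite 2 L → ℝ),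
        (∀ t ∈ Icc (0 : ℝ) 1, ∀ x y, ‖A j Qm t x y‖ ≤ mA U) ∧ (∀ t ∈ Icc (0 : ℝ) 1, ∀ x y, ‖A j' Qm t x y‖ ≤ mA U) ∧
        -- ANALYTIC INPUTS of the STEP's defect rows in MASSES form: kernel sups [class #1], smearing numbers [binomial–Gram], ≥ 2 cross lines rows,
        -- weight masses [k3c2-p2] — member 1's PH masses and member 2's CONVOLVED PH masses are DISCHARGED (rows 66/66♭); `Wd₂ Wx₂` serve the `(x,y)`-difference channel only —,
        -- localisation rows [(c) closer]
        0 ≤ M4 ∧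
        (∀ t ∈ Icc (0 : ℝ) 1, ∀ X, ‖V j t X‖ ≤ M4) ∧ (∀ t ∈ Icc (0 : ℝ) 1, ∀ X, ‖V j' t X‖ ≤ M4) ∧
        (∀ t ∈ Icc (0 : ℝ) 1, ∀ X, ‖V6 j t X‖ ≤ M6) ∧ (∀ t ∈ Icc (0 : ℝ) 1, ∀ X, ‖V6 j' t X‖ ≤ M6) ∧
        (∀ t ∈ Icc (0 : ℝ) 1, ∀ p σ, ‖Sg j t p σ‖ ≤ M2) ∧ (∀ t ∈ Icc (0 : ℝ) 1, ∀ p σ, ‖Sg j' t p σ‖ ≤ M2) ∧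
        (∀ t ∈ Icc (0 : ℝ) 1, ∀ X, ‖V j t X - V j' t X‖ ≤ η4) ∧ (∀ t ∈ Icc (0 : ℝ) 1, ∀ X, ‖V6 j t X - V6 j' t X‖ ≤ η6) ∧ (∀ t ∈ Icc (0 : ℝ) 1, ∀ p σ, ‖Sg j t p σ - Sg j' t p σ‖ ≤ η2) ∧
        (∀ t ∈ Icc (0 : ℝ) 1, ∀ x y : TorusSite 2 L, ‖Hd j t ![(((omega0 M, y), 0), 0), ((((omega0 M).rev, Qm - y), 1), 0), ((((omega0 M).rev, Qm - x), 1), 1), (((omega0 M, x), 0), 1)]‖ ≤ RH₁ x y) ∧ (∀ t ∈ Icc (0 : ℝ) 1, ∀ x y : TorusSite 2 L, ‖Hd j' t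
                ![(((omega0 M, y), 0), 0), ((((omega0 M).rev, Qm - y), 1), 0), ((((omega0 M).rev, Qm - x), 1), 1), (((omega0 M, x), 0), 1)]‖ ≤ RH₂ x y) ∧
        (∀ t ∈ Icc (0 : ℝ) 1, ∀ x y : TorusSite 2 L, ‖Hd j t ![(((omega0 M, y), 0), 0), ((((omega0 M).rev, Qm - y), 1), 0), ((((omega0 M).rev, Qm - x), 1), 1), (((omega0 M, x), 0), 1)] - Hd j' t ![(((omega0 M, y), 0), 0), ((((omega0 M).rev, Qm - y),
                1), 0), ((((omega0 M).rev, Qm - x), 1), 1), (((omega0 M, x), 0), 1)]‖ ≤ Rhd x y) ∧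
        (∀ t ∈ Icc (0 : ℝ) 1, ∀ x y : TorusSite 2 L, (∑ p : FreqMomentum L M, ∑ _σ : Fin 2, ‖(((((Wd t p) : ℝ) : ℂ) * (((β * (L : ℝ) ^ 2 : ℝ) : ℂ) * propCT L M β μ (klFlowFrameU L M β U μ (n + 1)) p)) * ((((Φ j t p) : ℝ) : ℂ) * (((β * (L : ℝ) ^ 2 :
                ℝ) : ℂ) * propCT L M β μ (klFlowFrameU L M β U μ (n + 1)) p)))‖) ≤ W6₁ x y) ∧
        (∀ t ∈ Icc (0 : ℝ) 1, ∀ x y : TorusSite 2 L, (∑ p : FreqMomentum L M, ∑ _σ : Fin 2, ∑ p' : FreqMomentum L M,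
            if matsubaraInt M p'.1 + matsubaraInt M (omega0 M) = matsubaraInt M p.1 + matsubaraInt M (omega0 M) ∧ p'.2 = p.2 + x - y then ‖((((((Φ j' t p) : ℝ) : ℂ) * (((β * (L : ℝ) ^ 2 : ℝ) : ℂ) * propCT L M β μ (klFlowFrameU L M β U μ (n + 1)) p))
                    * ((((Wd t p') : ℝ) : ℂ) * (((β * (L : ℝ) ^ 2 : ℝ) : ℂ) * propCT L M β μ (klFlowFrameU L M β U μ (n + 1)) p'))) + (((((Wd t p) : ℝ) : ℂ) * (((β * (L : ℝ) ^ 2 : ℝ) : ℂ) * propCT L M β μ (klFlowFrameU L M β U μ (n + 1)) p)) * ((((Φ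
                    j' t p') : ℝ) : ℂ) * (((β * (L : ℝ) ^ 2 : ℝ) : ℂ) * propCT L M β μ (klFlowFrameU L M β U μ (n + 1)) p'))))‖ else 0) ≤ Wd₂ x y) ∧
        (∀ t ∈ Icc (0 : ℝ) 1, ∀ x y : TorusSite 2 L, (∑ p : FreqMomentum L M, ∑ p' : FreqMomentum L M,
            if matsubaraInt M p'.1 + matsubaraInt M (omega0 M) + matsubaraInt M (omega0 M) + 1 = matsubaraInt M p.1 ∧ p'.2 = p.2 + Qm - x - y then ‖((((((Φ j' t p) : ℝ) : ℂ) * (((β * (L : ℝ) ^ 2 : ℝ) : ℂ) * propCT L M β μ (klFlowFrameU L M β U μ (n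
                    + 1)) p)) * ((((Wd t p') : ℝ) : ℂ) * (((β * (L : ℝ) ^ 2 : ℝ) : ℂ) * propCT L M β μ (klFlowFrameU L M β U μ (n + 1)) p'))) + (((((Wd t p) : ℝ) : ℂ) * (((β * (L : ℝ) ^ 2 : ℝ) : ℂ) * propCT L M β μ (klFlowFrameU L M β U μ (n + 1))
                    p)) * ((((Φ j' t p') : ℝ) : ℂ) * (((β * (L : ℝ) ^ 2 : ℝ) : ℂ) * propCT L M β μ (klFlowFrameU L M β U μ (n + 1)) p'))))‖ else 0) ≤ Wx₂ x y) ∧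
        (∀ t ∈ Icc (0 : ℝ) 1, ∀ x y : TorusSite 2 L, (∑ p : FreqMomentum L M, ∑ _σ : Fin 2, ‖(((((Wd t p) : ℝ) : ℂ) * (((β * (L : ℝ) ^ 2 : ℝ) : ℂ) * propCT L M β μ (klFlowFrameU L M β U μ (n + 1)) p)) * ((((Φ j' t p) : ℝ) : ℂ) * (((β * (L : ℝ) ^ 2 :
                ℝ) : ℂ) * propCT L M β μ (klFlowFrameU L M β U μ (n + 1)) p)))‖) ≤ W6₂ x y) ∧
        (∀ t ∈ Icc (0 : ℝ) 1, ∀ x y : TorusSite 2 L, (∑ p : FreqMomentum L M, ∑ _σ : Fin 2, ∑ p' : FreqMomentum L M,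
            if matsubaraInt M p'.1 + matsubaraInt M (omega0 M) = matsubaraInt M p.1 + matsubaraInt M (omega0 M) ∧ p'.2 = p.2 + x - y then ‖((((((((softSymbolCompl L M β μ (klFlowFrameU L M β U μ (n + 1)) (n + 1) j) p - (softSymbolCompl L M β μ
                    (klFlowFrameU L M β U μ (n + 1)) (n + 1) j') p)) : ℝ) : ℂ) * (((β * (L : ℝ) ^ 2 : ℝ) : ℂ) * propCT L M β μ (klFlowFrameU L M β U μ (n + 1)) p)) * ((((Wd t p') : ℝ) : ℂ) * (((β * (L : ℝ) ^ 2 : ℝ) : ℂ) * propCT L M β μ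
                    (klFlowFrameU L M β U μ (n + 1)) p'))) + (((((Wd t p) : ℝ) : ℂ) * (((β * (L : ℝ) ^ 2 : ℝ) : ℂ) * propCT L M β μ (klFlowFrameU L M β U μ (n + 1)) p)) * ((((((softSymbolCompl L M β μ (klFlowFrameU L M β U μ (n + 1)) (n + 1) j) p' -
                    (softSymbolCompl L M β μ (klFlowFrameU L M β U μ (n + 1)) (n + 1) j') p')) : ℝ) : ℂ) * (((β * (L : ℝ) ^ 2 : ℝ) : ℂ) * propCT L M β μ (klFlowFrameU L M β U μ (n + 1)) p'))))‖ else 0) ≤ WD₁ x y) ∧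
        (∀ t ∈ Icc (0 : ℝ) 1, ∀ x y : TorusSite 2 L, (∑ p : FreqMomentum L M, ∑ p' : FreqMomentum L M,
            if matsubaraInt M p'.1 + matsubaraInt M (omega0 M) + matsubaraInt M (omega0 M) + 1 = matsubaraInt M p.1 ∧ p'.2 = p.2 + Qm - x - y then ‖((((((((softSymbolCompl L M β μ (klFlowFrameU L M β U μ (n + 1)) (n + 1) j) p - (softSymbolCompl L M
                    β μ (klFlowFrameU L M β U μ (n + 1)) (n + 1) j') p)) : ℝ) : ℂ) * (((β * (L : ℝ) ^ 2 : ℝ) : ℂ) * propCT L M β μ (klFlowFrameU L M β U μ (n + 1)) p)) * ((((Wd t p') : ℝ) : ℂ) * (((β * (L : ℝ) ^ 2 : ℝ) : ℂ) * propCT L M β μ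
                    (klFlowFrameU L M β U μ (n + 1)) p'))) + (((((Wd t p) : ℝ) : ℂ) * (((β * (L : ℝ) ^ 2 : ℝ) : ℂ) * propCT L M β μ (klFlowFrameU L M β U μ (n + 1)) p)) * ((((((softSymbolCompl L M β μ (klFlowFrameU L M β U μ (n + 1)) (n + 1) j) p' -
                    (softSymbolCompl L M β μ (klFlowFrameU L M β U μ (n + 1)) (n + 1) j') p')) : ℝ) : ℂ) * (((β * (L : ℝ) ^ 2 : ℝ) : ℂ) * propCT L M β μ (klFlowFrameU L M β U μ (n + 1)) p'))))‖ else 0) ≤ WD₂ x y) ∧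
        (∀ t ∈ Icc (0 : ℝ) 1, ∀ x y : TorusSite 2 L, (∑ p : FreqMomentum L M, ∑ _σ : Fin 2, ‖(((((Wd t p) : ℝ) : ℂ) * (((β * (L : ℝ) ^ 2 : ℝ) : ℂ) * propCT L M β μ (klFlowFrameU L M β U μ (n + 1)) p)) * ((((((softSymbolCompl L M β μ (klFlowFrameU L
                M β U μ (n + 1)) (n + 1) j) p - (softSymbolCompl L M β μ (klFlowFrameU L M β U μ (n + 1)) (n + 1) j') p)) : ℝ) : ℂ) * (((β * (L : ℝ) ^ 2 : ℝ) : ℂ) * propCT L M β μ (klFlowFrameU L M β U μ (n + 1)) p)))‖) ≤ WD₃ x y) ∧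
        (∀ t ∈ Icc (0 : ℝ) 1, ∀ x y : TorusSite 2 L, ‖∑ z : TorusSite 2 L × MatsubaraIdx M, Br j Qm t z *
          ((if z.1 ∈ klBall L μ 0 then
              V j t ![(((omega0 M, z.1), 0), 0), ((((omega0 M).rev, Qm - z.1), 1), 0), ((((omega0 M).rev, Qm - x), 1), 1), (((omega0 M, x), 0), 1)] *
                V j t ![(((omega0 M, y), 0), 0), ((((omega0 M).rev, Qm - y), 1), 0), ((((omega0 M).rev, Qm - z.1), 1), 1), (((omega0 M, z.1), 0), 1)]
            else 0) -
            V j t ![(((z.2, z.1), 0), 0), (((z.2.rev, Qm - z.1), 1), 0), ((((omega0 M).rev, Qm - x), 1), 1), (((omega0 M, x), 0), 1)] *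
              V j t ![(((omega0 M, y), 0), 0), ((((omega0 M).rev, Qm - y), 1), 0), (((z.2.rev, Qm - z.1), 1), 1), (((z.2, z.1), 0), 1)])‖ ≤ RL₁ x y) ∧
        (∀ t ∈ Icc (0 : ℝ) 1, ∀ x y : TorusSite 2 L, ‖∑ z : TorusSite 2 L × MatsubaraIdx M, Br j' Qm t z *
          ((if z.1 ∈ klBall L μ 0 then
              V j' t ![(((omega0 M, z.1), 0), 0), ((((omega0 M).rev, Qm - z.1), 1), 0), ((((omega0 M).rev, Qm - x), 1), 1), (((omega0 M, x), 0), 1)] *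
                V j' t ![(((omega0 M, y), 0), 0), ((((omega0 M).rev, Qm - y), 1), 0), ((((omega0 M).rev, Qm - z.1), 1), 1), (((omega0 M, z.1), 0), 1)]
            else 0) -
            V j' t ![(((z.2, z.1), 0), 0), (((z.2.rev, Qm - z.1), 1), 0), ((((omega0 M).rev, Qm - x), 1), 1), (((omega0 M, x), 0), 1)] *
              V j' t ![(((omega0 M, y), 0), 0), ((((omega0 M).rev, Qm - y), 1), 0), (((z.2.rev, Qm - z.1), 1), 1), (((z.2, z.1), 0), 1)])‖ ≤ RL₂ x y) ∧
        (∀ t ∈ Icc (0 : ℝ) 1, ∀ x y : TorusSite 2 L, ‖∑ z : TorusSite 2 L × MatsubaraIdx M, (fun z : TorusSite 2 L × MatsubaraIdx M => -(((((β * (L : ℝ) ^ 2 : ℝ) : ℂ)))⁻¹ * propCT L M β μ (klFlowFrameU L M β U μ (n + 1)) (z.2, z.1) * propCT L M β μ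
                (klFlowFrameU L M β U μ (n + 1)) (z.2.rev, Qm - z.1)) * ((((klScale klE0 (n + 1) - klScale klE0 n) * (-Wd t (z.2, z.1) * ((softSymbolCompl L M β μ (klFlowFrameU L M β U μ (n + 1)) (n + 1) j) (z.2.rev, Qm - z.1) - (softSymbolCompl L M
                β μ (klFlowFrameU L M β U μ (n + 1)) (n + 1) j') (z.2.rev, Qm - z.1)) - ((softSymbolCompl L M β μ (klFlowFrameU L M β U μ (n + 1)) (n + 1) j) (z.2, z.1) - (softSymbolCompl L M β μ (klFlowFrameU L M β U μ (n + 1)) (n + 1) j') (z.2,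
                z.1)) * Wd t (z.2.rev, Qm - z.1))) : ℝ) : ℂ)) z *
          ((if z.1 ∈ klBall L μ 0 then
              V j t ![(((omega0 M, z.1), 0), 0), ((((omega0 M).rev, Qm - z.1), 1), 0), ((((omega0 M).rev, Qm - x), 1), 1), (((omega0 M, x), 0), 1)] *
                V j t ![(((omega0 M, y), 0), 0), ((((omega0 M).rev, Qm - y), 1), 0), ((((omega0 M).rev, Qm - z.1), 1), 1), (((omega0 M, z.1), 0), 1)]
            else 0) -
            V j t ![(((z.2, z.1), 0), 0), (((z.2.rev, Qm - z.1), 1), 0), ((((omega0 M).rev, Qm - x), 1), 1), (((omega0 M, x), 0), 1)] *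
              V j t ![(((omega0 M, y), 0), 0), ((((omega0 M).rev, Qm - y), 1), 0), (((z.2.rev, Qm - z.1), 1), 1), (((z.2, z.1), 0), 1)])‖ ≤ Rl₁ x y) ∧
        (∀ t ∈ Icc (0 : ℝ) 1, ∀ x y : TorusSite 2 L, ‖∑ z : TorusSite 2 L × MatsubaraIdx M, Br j' Qm t z *
          (((if z.1 ∈ klBall L μ 0 then
              V j t ![(((omega0 M, z.1), 0), 0), ((((omega0 M).rev, Qm - z.1), 1), 0), ((((omega0 M).rev, Qm - x), 1), 1), (((omega0 M, x), 0), 1)] *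
                V j t ![(((omega0 M, y), 0), 0), ((((omega0 M).rev, Qm - y), 1), 0), ((((omega0 M).rev, Qm - z.1), 1), 1), (((omega0 M, z.1), 0), 1)]
            else 0) -
            V j t ![(((z.2, z.1), 0), 0), (((z.2.rev, Qm - z.1), 1), 0), ((((omega0 M).rev, Qm - x), 1), 1), (((omega0 M, x), 0), 1)] *
              V j t ![(((omega0 M, y), 0), 0), ((((omega0 M).rev, Qm - y), 1), 0), (((z.2.rev, Qm - z.1), 1), 1), (((z.2, z.1), 0), 1)]) -
            ((if z.1 ∈ klBall L μ 0 then
              V j' t ![(((omega0 M, z.1), 0), 0), ((((omega0 M).rev, Qm - z.1), 1), 0), ((((omega0 M).rev, Qm - x), 1), 1), (((omega0 M, x), 0), 1)] *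
                V j' t ![(((omega0 M, y), 0), 0), ((((omega0 M).rev, Qm - y), 1), 0), ((((omega0 M).rev, Qm - z.1), 1), 1), (((omega0 M, z.1), 0), 1)]
            else 0) -
            V j' t ![(((z.2, z.1), 0), 0), (((z.2.rev, Qm - z.1), 1), 0), ((((omega0 M).rev, Qm - x), 1), 1), (((omega0 M, x), 0), 1)] *
              V j' t ![(((omega0 M, y), 0), 0), ((((omega0 M).rev, Qm - y), 1), 0), (((z.2.rev, Qm - z.1), 1), 1), (((z.2, z.1), 0), 1)]))‖ ≤ Rl₂ x y) ∧
        (∀ x y, ‖klMemberArrayF L M β U μ n (softSymbolCompl L M β μ (klFlowFrameU L M β U μ n) n j) Qm x y‖ ≤ mA U) ∧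
        -- (F)(i) [k3c2-p2]: majorants of the FRAME SHIFT `K_n → K_(n+1)` of the history members / relative weight (model objects)
        (∀ x y, ‖(((Matrix.of fun k k' : TorusSite 2 L => if k ∈ klBall L μ 0 ∧ k' ∈ klBall L μ 0 then
        klCovSmearedPairAmplitude L M β U μ (klFlowFrameU L M β U μ (n + 1)) n (softCovOf L M β μ (klFlowFrameU L M β U μ (n + 1)) (softSymbolCompl L M β μ (klFlowFrameU L M β U μ (n + 1)) n j)) Qm k k' else 0) -
        klMemberArrayF L M β U μ n (softSymbolCompl L M β μ (klFlowFrameU L M β U μ n) n j) Qm) -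
          ((Matrix.of fun k k' : TorusSite 2 L => if k ∈ klBall L μ 0 ∧ k' ∈ klBall L μ 0 then
        klCovSmearedPairAmplitude L M β U μ (klFlowFrameU L M β U μ (n + 1)) n (softCovOf L M β μ (klFlowFrameU L M β U μ (n + 1)) (softSymbolCompl L M β μ (klFlowFrameU L M β U μ (n + 1)) n j')) Qm k k' else 0) -
        klMemberArrayF L M β U μ n (softSymbolCompl L M β μ (klFlowFrameU L M β U μ n) n j') Qm)) x y‖ ≤ ηr x y) ∧
        (∀ x y, ‖((Matrix.of fun k k' : TorusSite 2 L => if k ∈ klBall L μ 0 ∧ k' ∈ klBall L μ 0 then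
        klCovSmearedPairAmplitude L M β U μ (klFlowFrameU L M β U μ (n + 1)) n (softCovOf L M β μ (klFlowFrameU L M β U μ (n + 1)) (softSymbolCompl L M β μ (klFlowFrameU L M β U μ (n + 1)) n j)) Qm k k' else 0) -
        klMemberArrayF L M β U μ n (softSymbolCompl L M β μ (klFlowFrameU L M β U μ n) n j) Qm) x y‖ ≤ η₁ x y) ∧
        (∀ x y, ‖((Matrix.of fun k k' : TorusSite 2 L => if k ∈ klBall L μ 0 ∧ k' ∈ klBall L μ 0 then
        klCovSmearedPairAmplitude L M β U μ (klFlowFrameU L M β U μ (n + 1)) n (softCovOf L M β μ (klFlowFrameU L M β U μ (n + 1)) (softSymbolCompl L M β μ (klFlowFrameU L M β U μ (n + 1)) n j')) Qm k k' else 0) -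
        klMemberArrayF L M β U μ n (softSymbolCompl L M β μ (klFlowFrameU L M β U μ n) n j') Qm) x y‖ ≤ η₂ x y) ∧
        (∀ c, ‖(fun p => -(((klTransferWeight L M β μ (klFlowFrameU L M β U μ (n + 1)) n (softSymbolCompl L M β μ (klFlowFrameU L M β U μ (n + 1)) n j) Qm p -
        klTransferWeight L M β μ (klFlowFrameU L M β U μ (n + 1)) n (softSymbolCompl L M β μ (klFlowFrameU L M β U μ (n + 1)) n j') Qm p : ℝ)) : ℂ)) c -
          (-(((klTransferWeight L M β μ (klFlowFrameU L M β U μ n) n (softSymbolCompl L M β μ (klFlowFrameU L M β U μ n) n j) Qm c -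
            klTransferWeight L M β μ (klFlowFrameU L M β U μ n) n (softSymbolCompl L M β μ (klFlowFrameU L M β U μ n) n j') Qm c : ℝ)) : ℂ))‖ ≤ d c) ∧
        (∀ x y, (ηr x y + mA U * ∑ c, η₁ x c * (d c + ‖(-(((klTransferWeight L M β μ (klFlowFrameU L M β U μ n) n (softSymbolCompl L M β μ (klFlowFrameU L M β U μ n) n j) Qm c -
            klTransferWeight L M β μ (klFlowFrameU L M β U μ n) n (softSymbolCompl L M β μ (klFlowFrameU L M β U μ n) n j') Qm c : ℝ)) : ℂ))‖) + mA U * mA U * ∑ c, d c + mA U * ∑ c, ‖(-(((klTransferWeight L M β μ (klFlowFrameU L M β U μ n) n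
                    (softSymbolCompl L M β μ (klFlowFrameU L M β U μ n) n j) Qm c -
            klTransferWeight L M β μ (klFlowFrameU L M β U μ n) n (softSymbolCompl L M β μ (klFlowFrameU L M β U μ n) n j') Qm c : ℝ)) : ℂ))‖ * η₂ c y) ≤ R₀ x y) ∧
        -- a `t`-uniform profile of the running relative weight (row 62) and its WINDOW DATA «(ᾱ)-WINDOW» (window floor `η₀ ≤ Λₙ₊₁`, density `Aw`, total `Z`, shell number `Ish`)
        (∀ t ∈ Icc (0 : ℝ) 1, ∀ c, ‖a j j' Qm t c‖ ≤ α c) ∧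
        η₀ ≤ klScale klE0 (n + 1) ∧
        (∀ x₀ : TorusSite 2 L, ∀ η : ℝ, η₀ ≤ η → ∑ c ∈ univ.filter (fun c : TorusSite 2 L => klTorusNorm L (c - x₀) ≤ η), α c ≤ Aw * η) ∧ ∑ c, α c ≤ Z ∧
        -- the analytic majorant `Ran`: re-frame part + D-classes at `(x,y)` + per member [remaining classes convolved against `α`] + M4²·(CONVOLVED PH masses DISCHARGED: flat `F·Z`
        -- at `n = 0`, k3c2-p2's two-shell convolution bound VERBATIM at `n ≥ 1` — slot types `Λₙ₊₁·Aw`, `2⁻ⁿ·Z`, `Ish·Λₙ₊₁·Aw`, `Z/2^Ish`)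
        (∀ x y, R₀ x y +
            (((klScale klE0 n - klScale klE0 (n + 1)) * (2⁻¹ * Rhd x y + ((β * (L : ℝ) ^ 2) ^ 3)⁻¹ * (M4 * M4 * WD₁ x y + (η4 * M4 + M4 * η4) * Wd₂ x y + M4 * M4 * WD₂ x y + (η4 * M4 + M4 * η4) * Wx₂ x y + 2 * (M6 * M2 * WD₃ x y + (η6 * M2 + M6 * η2) * W6₂ x y))) + (Rl₁ x y + Rl₂ x y)) +
              mA U * (∑ c, ((klScale klE0 n - klScale klE0 (n + 1)) * (2⁻¹ * RH₁ x c + ((β * (L : ℝ) ^ 2) ^ 3)⁻¹ * (2 * (M6 * M2 * W6₁ x c))) + RL₁ x c) * α c +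
                M4 * M4 * (if n = 0 then (2048 * 15367 : ℝ) * Z else
                  (2048 * 15367 : ℝ) * Aw * klScale klE0 (n + 1) + 512 / 3 * ((27 / (8 * Real.pi ^ 2)) * klTS * (16 / Real.pi) * (10 + 50 * (4 + 8 / 3 * R.Gfr 1 * U ^ 2) * β / L)) * (Real.sqrt 2 / 4 * ((2 : ℝ) ^ n)⁻¹) * Z +
        2 * Aw * ((512 / 3 * ((27 / (8 * Real.pi ^ 2)) * klTS * (16 / Real.pi) * (10 + 50 * (4 + 8 / 3 * R.Gfr 1 * U ^ 2) * β / L)) * (16384 * (4 + 8 / 3 * R.Gfr 1 * U ^ 2) ^ 2) + (2048 * 15367 : ℝ) / (8 * (4 + 8 / 3 * R.Gfr 1 * U ^ 2))) * klScale klE0 (n + 1)) * Ish +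
        (512 / 3 * ((27 / (8 * Real.pi ^ 2)) * klTS * (16 / Real.pi) * (10 + 50 * (4 + 8 / 3 * R.Gfr 1 * U ^ 2) * β / L)) * (16384 * (4 + 8 / 3 * R.Gfr 1 * U ^ 2) ^ 2) + (2048 * 15367 : ℝ) / (8 * (4 + 8 / 3 * R.Gfr 1 * U ^ 2))) * klScale klE0 (n + 1) * Z / (klScale klE0 (n + 1) * 2 ^ Ish)) +
                M4 * M4 * (if n = 0 then (1024 * 15367 : ℝ) * Z else
                  (1024 * 15367 : ℝ) * Aw * klScale klE0 (n + 1) + 256 / 3 * ((27 / (8 * Real.pi ^ 2)) * klTS * (16 / Real.pi) * (10 + 50 * (4 + 8 / 3 * R.Gfr 1 * U ^ 2) * β / L)) * (Real.sqrt 2 / 4 * ((2 : ℝ) ^ n)⁻¹) * Z +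
        2 * Aw * ((256 / 3 * ((27 / (8 * Real.pi ^ 2)) * klTS * (16 / Real.pi) * (10 + 50 * (4 + 8 / 3 * R.Gfr 1 * U ^ 2) * β / L)) * (16384 * (4 + 8 / 3 * R.Gfr 1 * U ^ 2) ^ 2) + (1024 * 15367 : ℝ) / (8 * (4 + 8 / 3 * R.Gfr 1 * U ^ 2))) * klScale klE0 (n + 1)) * Ish +
        (256 / 3 * ((27 / (8 * Real.pi ^ 2)) * klTS * (16 / Real.pi) * (10 + 50 * (4 + 8 / 3 * R.Gfr 1 * U ^ 2) * β / L)) * (16384 * (4 + 8 / 3 * R.Gfr 1 * U ^ 2) ^ 2) + (1024 * 15367 : ℝ) / (8 * (4 + 8 / 3 * R.Gfr 1 * U ^ 2))) * klScale klE0 (n + 1) * Z / (klScale klE0 (n + 1) * 2 ^ Ish))) +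
              mA U * (∑ c, α c * ((klScale klE0 n - klScale klE0 (n + 1)) * (2⁻¹ * RH₂ c y + ((β * (L : ℝ) ^ 2) ^ 3)⁻¹ * (2 * (M6 * M2 * W6₂ c y))) + RL₂ c y) +
                M4 * M4 * (if n = 0 then (2048 * 15367 : ℝ) * Z else
                  (2048 * 15367 : ℝ) * Aw * klScale klE0 (n + 1) + 512 / 3 * ((27 / (8 * Real.pi ^ 2)) * klTS * (16 / Real.pi) * (10 + 50 * (4 + 8 / 3 * R.Gfr 1 * U ^ 2) * β / L)) * (Real.sqrt 2 / 4 * ((2 : ℝ) ^ n)⁻¹) * Z +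
        2 * Aw * ((512 / 3 * ((27 / (8 * Real.pi ^ 2)) * klTS * (16 / Real.pi) * (10 + 50 * (4 + 8 / 3 * R.Gfr 1 * U ^ 2) * β / L)) * (16384 * (4 + 8 / 3 * R.Gfr 1 * U ^ 2) ^ 2) + (2048 * 15367 : ℝ) / (8 * (4 + 8 / 3 * R.Gfr 1 * U ^ 2))) * klScale klE0 (n + 1)) * Ish +
        (512 / 3 * ((27 / (8 * Real.pi ^ 2)) * klTS * (16 / Real.pi) * (10 + 50 * (4 + 8 / 3 * R.Gfr 1 * U ^ 2) * β / L)) * (16384 * (4 + 8 / 3 * R.Gfr 1 * U ^ 2) ^ 2) + (2048 * 15367 : ℝ) / (8 * (4 + 8 / 3 * R.Gfr 1 * U ^ 2))) * klScale klE0 (n + 1) * Z / (klScale klE0 (n + 1) * 2 ^ Ish)) +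
                M4 * M4 * (if n = 0 then (1024 * 15367 : ℝ) * Z else
                  (1024 * 15367 : ℝ) * Aw * klScale klE0 (n + 1) + 256 / 3 * ((27 / (8 * Real.pi ^ 2)) * klTS * (16 / Real.pi) * (10 + 50 * (4 + 8 / 3 * R.Gfr 1 * U ^ 2) * β / L)) * (Real.sqrt 2 / 4 * ((2 : ℝ) ^ n)⁻¹) * Z +
        2 * Aw * ((256 / 3 * ((27 / (8 * Real.pi ^ 2)) * klTS * (16 / Real.pi) * (10 + 50 * (4 + 8 / 3 * R.Gfr 1 * U ^ 2) * β / L)) * (16384 * (4 + 8 / 3 * R.Gfr 1 * U ^ 2) ^ 2) + (1024 * 15367 : ℝ) / (8 * (4 + 8 / 3 * R.Gfr 1 * U ^ 2))) * klScale klE0 (n + 1)) * Ish +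
        (256 / 3 * ((27 / (8 * Real.pi ^ 2)) * klTS * (16 / Real.pi) * (10 + 50 * (4 + 8 / 3 * R.Gfr 1 * U ^ 2) * β / L)) * (16384 * (4 + 8 / 3 * R.Gfr 1 * U ^ 2) ^ 2) + (1024 * 15367 : ℝ) / (8 * (4 + 8 / 3 * R.Gfr 1 * U ^ 2))) * klScale klE0 (n + 1) * Z / (klScale klE0 (n + 1) * 2 ^ Ish)))) ≤ Ran x y) ∧
        -- ITS budget: the four-term FT form of `Ran` against the frame slack of the inherited bar plus three fifths of the slice's ROOM
        (∀ k ∈ klBall L μ 0, ∀ k' ∈ klBall L μ 0,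
          Ran k k' + ∑ c, Ran k c * ρ j' Qm c * (3 / 2 * mA U) + ∑ a', 3 / 2 * mA U * ρ j Qm a' * Ran a' k' +
              ∑ a', ∑ c, 3 / 2 * mA U * ρ j Qm a' * Ran a' c * ρ j' Qm c * (3 / 2 * mA U) ≤
            θ * (((2 : ℝ) ^ (n + 2))⁻¹ * transferBarRelIdx L Gth P r β U n j' Qm k k' + 3 / 5 *
              (klIdxPrefactor r (n + 1) * ((P.Klam * U) ^ 2 *
              ((min (klTorusNorm L (k - k') / klScale klE0 (n + 1)) (klScale klE0 (n + 1) / klTorusNorm L (k - k')) +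
                  min (klTorusNorm L (k + k' - Qm) / klScale klE0 (n + 1)) (klScale klE0 (n + 1) / klTorusNorm L (k + k' - Qm)) +
                  ((2 : ℝ) ^ n)⁻¹ + 3 * ((L : ℝ))⁻¹) * klIdxMass n j' + ((4 : ℝ) ^ (n + 1))⁻¹ * klIdxOverlap (n + 1) j') +
            ((P.Klam * |U|) ^ 3 * ((2 : ℝ) ^ n)⁻¹ + 3 * thermalBar Gth P U β (n + 1)) * klIdxMass n j')))))
    (hexport : G.WF → ∀ Q : EngConsts, Q₀.IsRaiseOf Q →
      ∀ cc : ℝ, 0 < cc → cc ≤ klEngC₃6 P R →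
        ∀ μ ∈ klWindowC, ∀ U : ℝ, 0 < U → U ≤ klEngU₀10 P R cc → U ≤ u Q cc →
          ∀ β : ℝ, klBetaMin ≤ β → β ≤ Real.exp (cc / U ^ 2) →
            ∀ (L M : ℕ) [NeZero L] [NeZero M], klEngL₄ P R β U ≤ L → klEngM₃ β U L ≤ M →
              ∀ n : ℕ, n ≤ nScales β + 1 → IsKLRegime U cc (-((n : ℕ) : ℤ)) →
                HistP klPredsV17F2 L M G P Q R β U μ 0 (n) →
                  FrameOK R U (nScales β) μ (klFlowFrameU L M β U μ (n)) →
                    (∀ j ≤ n, LevelsUExportMixedAt L M (klCU2 P R Q₀) P β U μ j) →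
      ∀ j' : ℕ, n ≤ j' → j' ≤ nScales β + 1 → ∀ Qm : TorusSite 2 L, IsPairClassAt L Qm n →
        ∀ x y, ‖klMemberArrayF L M β U μ n (softSymbolCompl L M β μ (klFlowFrameU L M β U μ n) n j') Qm x y‖ ≤ mA U) :
    ∃ e : ℝ × (EngConsts → ℝ → ℝ), IsTransferPkg7 e ∧ PairTransferStep7 P R Q₀ G Gth e.1 e.2 := by
  refine exists_isTransferPkg7_of_step7 hr hrc (fun Q cc => lt_min (hu Q cc) (klTSU_pos R))
    (pairTransferStep7_of_analytic_resolved_convK (u := fun Q cc => min (u Q cc) (klTSU R)) mA hR hCF hKl hr hθ0 hθ h0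
      (fun Q cc U hU hUu => hmA Q cc U hU (hUu.trans (min_le_left _ _))) twoShellFrameAreaAt_klTS klTS_nonneg ?_
      (fun hG Q hQ cc hcc0 hcc μ hμ U hU hU10 hUu => hbase hG Q hQ cc hcc0 hcc μ hμ U hU hU10 (hUu.trans (min_le_left _ _)))
      (fun hG Q hQ cc hcc0 hcc μ hμ U hU hU10 hUu => hsucc hG Q hQ cc hcc0 hcc μ hμ U hU hU10 (hUu.trans (min_le_left _ _)))
      (fun hG Q hQ cc hcc0 hcc μ hμ U hU hU10 hUu => hexport hG Q hQ cc hcc0 hcc μ hμ U hU hU10 (hUu.trans (min_le_left _ _))))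
  intro hG Q hQ cc hcc0 hcc μ hμ U hU hU10 hUu β hβ hβc L M _ _ hL hM n hn hreg
  have hGL' := hGL cc hcc0 hcc U hU hU10 β hβ hβc L hL
  have h1 := pi_div_four_mul_le_klScale_of_le_nScales_succ hβ hn
  have hGfr : 0 ≤ R.Gfr 1 := hR.wf.2.2 1
  have hβ0 : 0 < β := pos_of_klBetaMin_le hβ
  have hG0 : 0 < 4 + 8 / 3 * R.Gfr 1 * U ^ 2 := by positivity
  have hL0 : (0 : ℝ) < L := lt_of_lt_of_le (by positivity) hGL'
  have hGδ : (4 + 8 / 3 * R.Gfr 1 * U ^ 2) * (2 * Real.pi / L) ≤ klScale klE0 (n + 1) := by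
    refine le_trans ?_ h1
    rw [← mul_div_assoc, div_le_div_iff₀ hL0 (by positivity)]
    nlinarith [Real.pi_pos]
  exact ⟨hUu.trans (min_le_right _ _), h1, hGδ, fun hn1 => (tail_regime_readings β hR hβ hn1 (by omega) hGL').2.2⟩

end Producer

end Summit.HubbardSuperconductivity.HubbardSuperconductivity.Theorems.KLRegimeSplit

end
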